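import Literature.Topology.Immersions.HolonomicApproxPrelim
import Mathlib.Analysis.SpecialFunctions.Trigonometric.Deriv
import Mathlib.Analysis.Calculus.ContDiff.Bounds
import HarnessLib

/-!
# Holonomic approximation over a cube: the explicit wiggled section

Topic `Literature/Topology/Immersions`; second file of the holonomic approximation engine
(Eliashberg–Mishachev 2002, Thm. 3.1.1–3.1.2, `1`-jets, target a normed space `G`) behind
`Literature.Topology.Immersions.Phillips1967_exists_isLocalDiffeomorph_of_isParallelizable`.

**Setting.** `ℝⁿ = EuclideanSpace ℝ (Fin n)` with `k < n` *tangential* coordinates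
`t = (z₀, …, z_{k-1})`, the *wiggle* coordinate `u = z_k` and the remaining normal coordinates;
the cube `K = [-1, 1]ᵏ × 0`; a smooth map `f : ℝⁿ → G` and a smooth field of would-be
derivatives `A : ℝⁿ → L(ℝⁿ, G)` (a section `(f, A)` of the `1`-jet bundle), holonomic
(`Df = A`) on the part of the coordinate `k`-plane near `∂K`.

**The construction** (`Setup.g`, `Setup.shear`; our rendering of E–M §3.4–3.6 with all choices
explicit and no integrals):
* `proj` the projection (`π`) onto the `k`-plane, `χ` a plateau cutoff in `t` around `K`;
* the defects `bᵢ = χ · (A∘π − Df∘π) e_{tᵢ}` (tangential) and `w_l = χ · (A∘π − Df∘π) e_l`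
  (normal), and the first-order corrected `f₁ = f + Σ_{l ≥ k} z_l w_l`, whose normal derivatives
  on the plane are those prescribed by `A`;
* the wiggles `θ_l = a_l β(t) sin(N_l t_l)` (`β` a plateau cutoff vanishing near `∂K`),
  partial sums `Θᵢ = Σ_{l ≤ i} θ_l`, total `Θ`;
* the corrections `cᵢ = -(2/(aᵢNᵢ)) cos(Nᵢ tᵢ) bᵢ`, `dᵢ = -(1/(2Nᵢ)) sin(2Nᵢtᵢ) bᵢ`;
* **the section** `g = f₁ + Σᵢ ((u - Θᵢ) cᵢ + dᵢ)` and **the shear** `h(z) = z + Θ(t) ψ(z) e_k`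
  (`ψ` a normal cutoff).
Along the wiggled cube `h(K) = {u = Θ(t)}` the tangential derivative of `g` in direction `tᵢ`
picks up `-cᵢ ∂ᵢΘᵢ + ∂ᵢdᵢ = 2cos²(Nᵢtᵢ) bᵢ - cos(2Nᵢtᵢ) bᵢ + O(1/Nᵢ) = bᵢ + O(1/Nᵢ)`, exactly
the missing defect, while `cᵢ, dᵢ = O(1/Nᵢ)` keep `g` and its normal derivatives close to
`(f, A)`; amplitudes decrease and frequencies increase fast in `i` so that cross terms are small
(`HolonomicApproxCube.lean`).

This file: the definitions, their smoothness, the vanishing of all corrections where the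
defects vanish (relative version) and off the cutoffs, and the values on the wiggled cube.

## References

* Y. Eliashberg, N. Mishachev, *Introduction to the `h`-principle*, GSM 48 (2002), Thm. 3.1.1,
  3.1.2 and §§3.4–3.6. [EliashbergMishachev2002]
* M. Gromov, *Partial differential relations* (1986), 2.2.1. [Gromov1986PDR]
-/

open scoped Topology ContDiff
open Set Function Filter Real

noncomputable section

namespace Literature.Topology.Immersions.HolonomicApprox

variable {n : ℕ} {G : Type*} [NormedAddCommGroup G] [NormedSpace ℝ G]

/-! ### Plateau cutoffs (chosen once and for all) -/

/-- A smooth plateau function `= 1` on `[-l, l]`, `= 0` off `(-l', l')`, with values in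
`[0, 1]` and bounded derivative (a choice, `exists_plateau₁_deriv_bound`). [folklore] -/
def plateau (l l' : ℝ) (h : l < l') : ℝ → ℝ :=
  Classical.choose (exists_plateau₁_deriv_bound h)

/-- Auxiliary item `plateau_spec` of the explicit holonomic-approximation construction. [cite:
EliashbergMishachev2002, Thm. 3.1.2 (proof)] -/
theorem plateau_spec {l l' : ℝ} (h : l < l') :
    ContDiff ℝ ∞ (plateau l l' h) ∧ (∀ s, plateau l l' h s ∈ Icc (0 : ℝ) 1) ∧
      (∀ s, |s| ≤ l → plateau l l' h s = 1) ∧ (∀ s, l' ≤ |s| → plateau l l' h s = 0) ∧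
      ∃ C : ℝ, 0 ≤ C ∧ ∀ s, |deriv (plateau l l' h) s| ≤ C :=
  Classical.choose_spec (exists_plateau₁_deriv_bound h)

/-- Smoothness of `plateau` (explicit formula). [folklore] -/
theorem contDiff_plateau {l l' : ℝ} (h : l < l') : ContDiff ℝ ∞ (plateau l l' h) :=
  (plateau_spec h).1

/-- `plateau` takes values in `[0, 1]`. [folklore] -/
theorem plateau_mem_Icc {l l' : ℝ} (h : l < l') (s : ℝ) : plateau l l' h s ∈ Icc (0 : ℝ) 1 :=
  (plateau_spec h).2.1 s

/-- Where the cutoff `plateau` equals `1`. [folklore] -/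
theorem plateau_eq_one {l l' : ℝ} (h : l < l') {s : ℝ} (hs : |s| ≤ l) : plateau l l' h s = 1 :=
  (plateau_spec h).2.2.1 s hs

/-- Where `plateau` vanishes. [folklore] -/
theorem plateau_eq_zero {l l' : ℝ} (h : l < l') {s : ℝ} (hs : l' ≤ |s|) : plateau l l' h s = 0 :=
  (plateau_spec h).2.2.2.1 s hs

/-- Absolute-value estimate for `plateau`. [cite: EliashbergMishachev2002, Thm. 3.1.2 (proof)] -/
theorem abs_plateau_le_one {l l' : ℝ} (h : l < l') (s : ℝ) : |plateau l l' h s| ≤ 1 := by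
  have := plateau_mem_Icc h s
  rw [abs_of_nonneg this.1]; exact this.2

/-! ### The data -/

variable (n G) in
/-- **Data of the construction**: the number `k < n` of tangential coordinates, the section
`(f, A)`, the margin `ρ` of the relative region, and the three parameters `a₀` (largest
amplitude), `η` (ratio) and `Λ` (frequency scale). No hypotheses are stored. [folklore] -/
structure Setup where
  /-- Number of tangential coordinates. -/
  k : ℕ
  /-- Positive codimension. -/
  hk : k < n
  /-- The `0`-jet part of the section. -/
  f : EuclideanSpace ℝ (Fin n) → G
  /-- The `1`-jet part of the section. -/
  A : EuclideanSpace ℝ (Fin n) → (EuclideanSpace ℝ (Fin n) →L[ℝ] G)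
  /-- Margin of the relative region near `∂K`. -/
  ρ : ℝ
  /-- Margin is positive. -/
  hρ : 0 < ρ
  /-- Margin is less than `1`. -/
  hρ1 : ρ < 1
  /-- Largest amplitude. -/
  a₀ : ℝ
  /-- Ratio between consecutive amplitudes. -/
  η : ℝ
  /-- Frequency scale: `aᵢ Nᵢ = Λ η⁻ⁱ`. -/
  Λ : ℝ

namespace Setup

variable (S : Setup n G)

/-- The `i`-th tangential coordinate index. [cite: EliashbergMishachev2002, Thm. 3.1.2 (proof)] -/
def tang (i : Fin S.k) : Fin n := Fin.castLE (Nat.le_of_lt S.hk) i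

/-- The wiggle (first normal) coordinate index `κ = k`.
[cite: EliashbergMishachev2002, Thm. 3.1.2 (proof)] -/
def κ : Fin n := ⟨S.k, S.hk⟩

/-- Tangential coordinate indices (`tang_val`). [folklore] -/
@[simp] theorem tang_val (i : Fin S.k) : (S.tang i).val = i.val := rfl
/-- The wiggle coordinate index (`κ_val`). [folklore] -/
@[simp] theorem κ_val : S.κ.val = S.k := rfl

/-- Tangential coordinate indices (`tang_injective`). [folklore] -/
theorem tang_injective : Injective S.tang := Fin.castLE_injective (Nat.le_of_lt S.hk)

/-- Tangential coordinate indices (`tang_ne_κ`). [folklore] -/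
theorem tang_ne_κ (i : Fin S.k) : S.tang i ≠ S.κ := by
  intro h; have := congrArg Fin.val h; simp at this; omega

/-- Tangential coordinate indices (`tang_lt`). [folklore] -/
theorem tang_lt (i : Fin S.k) : (S.tang i).val < S.k := by simp

/-- A coordinate index is *normal* if it is `≥ k`.
[cite: EliashbergMishachev2002, Thm. 3.1.2 (proof)] -/
def IsNormal (l : Fin n) : Prop := S.k ≤ l.val

/-- Decidability of being a normal index. [folklore] -/
instance (l : Fin n) : Decidable (S.IsNormal l) := inferInstanceAs (Decidable (S.k ≤ l.val))

/-- Index bookkeeping (`isNormal_κ`). [folklore] -/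
theorem isNormal_κ : S.IsNormal S.κ := le_rfl

/-- Index bookkeeping (`not_isNormal_tang`). [folklore] -/
theorem not_isNormal_tang (i : Fin S.k) : ¬ S.IsNormal (S.tang i) := by
  simp [IsNormal]

/-- Index bookkeeping (`ne_tang_of_isNormal`). [folklore] -/
theorem ne_tang_of_isNormal {l : Fin n} (hl : S.IsNormal l) (i : Fin S.k) : l ≠ S.tang i := by
  rintro rfl; exact S.not_isNormal_tang i hl

/-- Index bookkeeping (`exists_tang_of_not_isNormal`). [folklore] -/
theorem exists_tang_of_not_isNormal {l : Fin n} (hl : ¬ S.IsNormal l) : ∃ i, S.tang i = l :=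
  ⟨⟨l.val, not_le.1 hl⟩, Fin.ext rfl⟩

/-- The amplitudes `aᵢ = a₀ ηⁱ`. [cite: EliashbergMishachev2002, Thm. 3.1.2 (proof)] -/
def a (i : Fin S.k) : ℝ := S.a₀ * S.η ^ (i : ℕ)

/-- The frequencies `Nᵢ = Λ η^{-2i} / a₀`, so that `aᵢ Nᵢ = Λ η⁻ⁱ`.
[cite: EliashbergMishachev2002, Thm. 3.1.2 (proof)] -/
def N (i : Fin S.k) : ℝ := S.Λ * (S.η ^ (2 * (i : ℕ)))⁻¹ / S.a₀

/-! ### The cutoffs and the projection -/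

/-- The projection onto the tangential `k`-plane.
[cite: EliashbergMishachev2002, Thm. 3.1.2 (proof)] -/
def proj (z : EuclideanSpace ℝ (Fin n)) : EuclideanSpace ℝ (Fin n) :=
  ∑ i : Fin S.k, z (S.tang i) • eV (S.tang i)

/-- Evaluation formula for `proj`. [folklore] -/
theorem proj_apply_tang (z : EuclideanSpace ℝ (Fin n)) (i : Fin S.k) : S.proj z (S.tang i) = z (S.tang i) := by
  simp only [proj, WithLp.ofLp_sum, WithLp.ofLp_smul, Finset.sum_apply, Pi.smul_apply, eV,
    EuclideanSpace.single, smul_eq_mul]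
  rw [Finset.sum_eq_single i]
  · simp
  · intro j _ hji
    have : S.tang j ≠ S.tang i := fun h => hji (S.tang_injective h)
    simp [Ne.symm this]
  · intro hi; exact absurd (Finset.mem_univ i) hi

/-- Evaluation formula for `proj`. [folklore] -/
theorem proj_apply_of_isNormal (z : EuclideanSpace ℝ (Fin n)) {l : Fin n} (hl : S.IsNormal l) :
    S.proj z l = 0 := by
  simp only [proj, WithLp.ofLp_sum, WithLp.ofLp_smul, Finset.sum_apply, Pi.smul_apply, eV,
    EuclideanSpace.single, smul_eq_mul]
  refine Finset.sum_eq_zero fun i _ => ?_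
  simp [S.ne_tang_of_isNormal hl i]

/-- `proj` is linear (as a function it is `ContDiff`). [folklore] -/
theorem contDiff_proj : ContDiff ℝ ∞ S.proj := by
  unfold proj
  refine ContDiff.sum fun i _ => ?_
  exact (contDiff_coord (S.tang i)).smul contDiff_const

/-- The plane cutoff `χ(t) = Πᵢ β₂(tᵢ)`, `β₂ = 1` on `[-(1 + ρ/4), 1 + ρ/4]`, `= 0` off
`(-(1 + ρ/2), 1 + ρ/2)`. [cite: EliashbergMishachev2002, Thm. 3.1.2 (proof)] -/
def χ (z : EuclideanSpace ℝ (Fin n)) : ℝ :=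
  ∏ i : Fin S.k, plateau (1 + S.ρ / 4) (1 + S.ρ / 2) (by linarith [S.hρ]) (z (S.tang i))

/-- The wiggle cutoff `β(t) = Πᵢ β₁(tᵢ)`, `β₁ = 1` on `[-(1 - ρ/2), 1 - ρ/2]`, `= 0` off
`(-(1 - ρ/4), 1 - ρ/4)` (so the shear is the identity within `ρ/4` of `∂K`).
[cite: EliashbergMishachev2002, Thm. 3.1.2 (proof)] -/
def β (z : EuclideanSpace ℝ (Fin n)) : ℝ :=
  ∏ i : Fin S.k, plateau (1 - S.ρ / 2) (1 - S.ρ / 4) (by linarith [S.hρ]) (z (S.tang i))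

/-- The normal cutoff `ψ(z) = Π_{l ≥ k} β₃(z_l)`, `β₃ = 1` on `[-1, 1]`, `= 0` off `(-2, 2)`.
[cite: EliashbergMishachev2002, Thm. 3.1.2 (proof)] -/
def ψ (z : EuclideanSpace ℝ (Fin n)) : ℝ :=
  ∏ l ∈ Finset.univ.filter (fun l : Fin n => S.IsNormal l), plateau 1 2 (by norm_num) (z l)

/-! ### Defects, first-order correction, wiggles, corrections, the section, the shear -/

/-- The tangential defect `bᵢ = χ · (A∘π − Df∘π) e_{tᵢ}`.
[cite: EliashbergMishachev2002, Thm. 3.1.2 (proof)] -/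
def b (i : Fin S.k) (z : EuclideanSpace ℝ (Fin n)) : G :=
  S.χ z • (S.A (S.proj z) (eV (S.tang i)) - fderiv ℝ S.f (S.proj z) (eV (S.tang i)))

/-- The normal defect `w_l = χ · (A∘π − Df∘π) e_l`.
[cite: EliashbergMishachev2002, Thm. 3.1.2 (proof)] -/
def w (l : Fin n) (z : EuclideanSpace ℝ (Fin n)) : G :=
  S.χ z • (S.A (S.proj z) (eV l) - fderiv ℝ S.f (S.proj z) (eV l))

/-- The first-order corrected map `f₁ = f + Σ_{l ≥ k} z_l w_l`.
[cite: EliashbergMishachev2002, Thm. 3.1.2 (proof)] -/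
def f₁ (z : EuclideanSpace ℝ (Fin n)) : G :=
  S.f z + ∑ l ∈ Finset.univ.filter (fun l : Fin n => S.IsNormal l), z l • S.w l z

/-- The wiggle `θ_l = a_l β(t) sin(N_l t_l)`. [cite: EliashbergMishachev2002, Thm. 3.1.2 (proof)] -/
def θ (l : Fin S.k) (z : EuclideanSpace ℝ (Fin n)) : ℝ :=
  S.a l * S.β z * Real.sin (S.N l * z (S.tang l))

/-- The partial sums `Θᵢ = Σ_{l ≤ i} θ_l`. [cite: EliashbergMishachev2002, Thm. 3.1.2 (proof)] -/
def Θ (i : Fin S.k) (z : EuclideanSpace ℝ (Fin n)) : ℝ :=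
  ∑ l ∈ Finset.univ.filter (fun l : Fin S.k => l ≤ i), S.θ l z

/-- The total wiggle `Θ = Σ_l θ_l`. [cite: EliashbergMishachev2002, Thm. 3.1.2 (proof)] -/
def Θtot (z : EuclideanSpace ℝ (Fin n)) : ℝ := ∑ l : Fin S.k, S.θ l z

/-- The correction `cᵢ = -(2/(aᵢNᵢ)) cos(Nᵢtᵢ) bᵢ`.
[cite: EliashbergMishachev2002, Thm. 3.1.2 (proof)] -/
def c (i : Fin S.k) (z : EuclideanSpace ℝ (Fin n)) : G :=
  (-(2 / (S.a i * S.N i)) * Real.cos (S.N i * z (S.tang i))) • S.b i z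

/-- The correction `dᵢ = -(1/(2Nᵢ)) sin(2Nᵢtᵢ) bᵢ`.
[cite: EliashbergMishachev2002, Thm. 3.1.2 (proof)] -/
def d (i : Fin S.k) (z : EuclideanSpace ℝ (Fin n)) : G :=
  (-(1 / (2 * S.N i)) * Real.sin (2 * S.N i * z (S.tang i))) • S.b i z

/-- **The wiggled section** `g = f₁ + Σᵢ ((u - Θᵢ) cᵢ + dᵢ)`, `u = z_k`.
[cite: EliashbergMishachev2002, Thm. 3.1.2 (proof)] -/
def g (z : EuclideanSpace ℝ (Fin n)) : G :=
  S.f₁ z + ∑ i : Fin S.k, ((z S.κ - S.Θ i z) • S.c i z + S.d i z)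

/-- **The shear** `h(z) = z + Θ(t) ψ(z) e_k`, carrying the cube `K` to the wiggled cube.
[cite: EliashbergMishachev2002, Thm. 3.1.2 (proof)] -/
def shear (z : EuclideanSpace ℝ (Fin n)) : EuclideanSpace ℝ (Fin n) :=
  z + (S.Θtot z * S.ψ z) • eV S.κ

/-! ### Smoothness -/

section Smooth

variable {S}
variable (hf : ContDiff ℝ ∞ S.f) (hA : ContDiff ℝ ∞ S.A)
include hf hA

omit hf hA in
/-- Smoothness of `χ` (explicit formula). [folklore] -/
theorem contDiff_χ : ContDiff ℝ ∞ S.χ := by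
  unfold χ
  exact contDiff_prod fun i _ => (contDiff_plateau _).comp (contDiff_coord _)

omit hf hA in
/-- Smoothness of `β` (explicit formula). [folklore] -/
theorem contDiff_β : ContDiff ℝ ∞ S.β := by
  unfold β
  exact contDiff_prod fun i _ => (contDiff_plateau _).comp (contDiff_coord _)

omit hf hA in
/-- Smoothness of `ψ` (explicit formula). [folklore] -/
theorem contDiff_ψ : ContDiff ℝ ∞ S.ψ := by
  unfold ψ
  exact contDiff_prod fun i _ => (contDiff_plateau _).comp (contDiff_coord _)

omit hA in
/-- `z ↦ Df(π z)` is smooth. [folklore] -/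
theorem contDiff_fderiv_comp_proj : ContDiff ℝ ∞ fun z => fderiv ℝ S.f (S.proj z) :=
  (hf.fderiv_right (m := ∞) (by simp)).comp S.contDiff_proj

/-- Smoothness of `b` (explicit formula). [folklore] -/
theorem contDiff_b (i : Fin S.k) : ContDiff ℝ ∞ (S.b i) := by
  unfold b
  exact S.contDiff_χ.smul (((hA.comp S.contDiff_proj).clm_apply contDiff_const).sub
    ((contDiff_fderiv_comp_proj hf).clm_apply contDiff_const))

/-- Smoothness of `w` (explicit formula). [folklore] -/
theorem contDiff_w (l : Fin n) : ContDiff ℝ ∞ (S.w l) := by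
  unfold w
  exact S.contDiff_χ.smul (((hA.comp S.contDiff_proj).clm_apply contDiff_const).sub
    ((contDiff_fderiv_comp_proj hf).clm_apply contDiff_const))

/-- Smoothness of `f₁` (explicit formula). [folklore] -/
theorem contDiff_f₁ : ContDiff ℝ ∞ S.f₁ := by
  unfold f₁
  exact hf.add (ContDiff.sum fun l _ => (contDiff_coord l).smul (contDiff_w hf hA l))

omit hf hA in
/-- Smoothness of `θ` (explicit formula). [folklore] -/
theorem contDiff_θ (l : Fin S.k) : ContDiff ℝ ∞ (S.θ l) := by
  unfold θ
  exact (contDiff_const.mul S.contDiff_β).mul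
    (Real.contDiff_sin.comp (contDiff_const.mul (contDiff_coord _)))

omit hf hA in
/-- Smoothness of `Θ` (explicit formula). [folklore] -/
theorem contDiff_Θ (i : Fin S.k) : ContDiff ℝ ∞ (S.Θ i) := by
  unfold Θ
  exact ContDiff.sum fun l _ => S.contDiff_θ l

omit hf hA in
/-- Smoothness of `Θtot` (explicit formula). [folklore] -/
theorem contDiff_Θtot : ContDiff ℝ ∞ S.Θtot := by
  unfold Θtot
  exact ContDiff.sum fun l _ => S.contDiff_θ l

/-- Smoothness of `c` (explicit formula). [folklore] -/
theorem contDiff_c (i : Fin S.k) : ContDiff ℝ ∞ (S.c i) := by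
  unfold c
  exact (contDiff_const.mul (Real.contDiff_cos.comp (contDiff_const.mul (contDiff_coord _)))).smul
    (contDiff_b hf hA i)

/-- Smoothness of `d` (explicit formula). [folklore] -/
theorem contDiff_d (i : Fin S.k) : ContDiff ℝ ∞ (S.d i) := by
  unfold d
  exact (contDiff_const.mul (Real.contDiff_sin.comp (contDiff_const.mul (contDiff_coord _)))).smul
    (contDiff_b hf hA i)

/-- **The wiggled section is smooth.** [folklore] -/
theorem contDiff_g : ContDiff ℝ ∞ S.g := by
  unfold g
  refine (contDiff_f₁ hf hA).add (ContDiff.sum fun i _ => ?_)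
  exact (((contDiff_coord _).sub (S.contDiff_Θ i)).smul (contDiff_c hf hA i)).add
    (contDiff_d hf hA i)

omit hf hA in
/-- **The shear is smooth.** [folklore] -/
theorem contDiff_shear : ContDiff ℝ ∞ S.shear := by
  unfold shear
  exact contDiff_id.add ((S.contDiff_Θtot.mul S.contDiff_ψ).smul contDiff_const)

end Smooth

/-! ### Dependence on the tangential coordinates only -/

section Tangential

/-- `proj` is invariant under translations in a normal coordinate direction. [folklore] -/
theorem proj_add_smul_eV_of_isNormal (z : EuclideanSpace ℝ (Fin n)) (s : ℝ) {l : Fin n}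
    (hl : S.IsNormal l) : S.proj (z + s • eV l) = S.proj z := by
  unfold proj
  refine Finset.sum_congr rfl fun i _ => ?_
  rw [add_smul_eV_apply_of_ne _ _ (S.ne_tang_of_isNormal hl i).symm]

/-- `apply_tang` is invariant under translations in a normal coordinate direction. [folklore] -/
theorem apply_tang_add_smul_eV_of_isNormal (z : EuclideanSpace ℝ (Fin n)) (s : ℝ) {l : Fin n}
    (hl : S.IsNormal l) (i : Fin S.k) : (z + s • eV l) (S.tang i) = z (S.tang i) :=
  add_smul_eV_apply_of_ne _ _ (S.ne_tang_of_isNormal hl i).symm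

/-- `χ` is invariant under translations in a normal coordinate direction. [folklore] -/
theorem χ_add_smul_eV_of_isNormal (z : EuclideanSpace ℝ (Fin n)) (s : ℝ) {l : Fin n}
    (hl : S.IsNormal l) : S.χ (z + s • eV l) = S.χ z := by
  unfold χ; simp_rw [S.apply_tang_add_smul_eV_of_isNormal z s hl]

/-- `β` is invariant under translations in a normal coordinate direction. [folklore] -/
theorem β_add_smul_eV_of_isNormal (z : EuclideanSpace ℝ (Fin n)) (s : ℝ) {l : Fin n}
    (hl : S.IsNormal l) : S.β (z + s • eV l) = S.β z := by
  unfold β; simp_rw [S.apply_tang_add_smul_eV_of_isNormal z s hl]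

/-- `b` is invariant under translations in a normal coordinate direction. [folklore] -/
theorem b_add_smul_eV_of_isNormal (i : Fin S.k) (z : EuclideanSpace ℝ (Fin n)) (s : ℝ)
    {l : Fin n} (hl : S.IsNormal l) : S.b i (z + s • eV l) = S.b i z := by
  unfold b; rw [S.χ_add_smul_eV_of_isNormal z s hl, S.proj_add_smul_eV_of_isNormal z s hl]

/-- `w` is invariant under translations in a normal coordinate direction. [folklore] -/
theorem w_add_smul_eV_of_isNormal (l' : Fin n) (z : EuclideanSpace ℝ (Fin n)) (s : ℝ)
    {l : Fin n} (hl : S.IsNormal l) : S.w l' (z + s • eV l) = S.w l' z := by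
  unfold w; rw [S.χ_add_smul_eV_of_isNormal z s hl, S.proj_add_smul_eV_of_isNormal z s hl]

/-- `θ` is invariant under translations in a normal coordinate direction. [folklore] -/
theorem θ_add_smul_eV_of_isNormal (i : Fin S.k) (z : EuclideanSpace ℝ (Fin n)) (s : ℝ)
    {l : Fin n} (hl : S.IsNormal l) : S.θ i (z + s • eV l) = S.θ i z := by
  unfold θ; rw [S.β_add_smul_eV_of_isNormal z s hl, S.apply_tang_add_smul_eV_of_isNormal z s hl]

/-- `Θ` is invariant under translations in a normal coordinate direction. [folklore] -/
theorem Θ_add_smul_eV_of_isNormal (i : Fin S.k) (z : EuclideanSpace ℝ (Fin n)) (s : ℝ)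
    {l : Fin n} (hl : S.IsNormal l) : S.Θ i (z + s • eV l) = S.Θ i z := by
  unfold Θ; simp_rw [S.θ_add_smul_eV_of_isNormal _ z s hl]

/-- `Θtot` is invariant under translations in a normal coordinate direction. [folklore] -/
theorem Θtot_add_smul_eV_of_isNormal (z : EuclideanSpace ℝ (Fin n)) (s : ℝ)
    {l : Fin n} (hl : S.IsNormal l) : S.Θtot (z + s • eV l) = S.Θtot z := by
  unfold Θtot; simp_rw [S.θ_add_smul_eV_of_isNormal _ z s hl]

/-- `c` is invariant under translations in a normal coordinate direction. [folklore] -/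
theorem c_add_smul_eV_of_isNormal (i : Fin S.k) (z : EuclideanSpace ℝ (Fin n)) (s : ℝ)
    {l : Fin n} (hl : S.IsNormal l) : S.c i (z + s • eV l) = S.c i z := by
  unfold c; rw [S.b_add_smul_eV_of_isNormal i z s hl, S.apply_tang_add_smul_eV_of_isNormal z s hl]

/-- `d` is invariant under translations in a normal coordinate direction. [folklore] -/
theorem d_add_smul_eV_of_isNormal (i : Fin S.k) (z : EuclideanSpace ℝ (Fin n)) (s : ℝ)
    {l : Fin n} (hl : S.IsNormal l) : S.d i (z + s • eV l) = S.d i z := by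
  unfold d; rw [S.b_add_smul_eV_of_isNormal i z s hl, S.apply_tang_add_smul_eV_of_isNormal z s hl]

/-- A function constant along the coordinate line `z + s eₗ` has vanishing partial `∂ₗ`.
[folklore] -/
theorem fderiv_apply_eq_zero_of_forall_add_smul {E' : Type*} [NormedAddCommGroup E']
    [NormedSpace ℝ E'] {φ : EuclideanSpace ℝ (Fin n) → E'} {z : EuclideanSpace ℝ (Fin n)}
    (hφ : DifferentiableAt ℝ φ z) {l : Fin n} (h : ∀ s : ℝ, φ (z + s • eV l) = φ z) :
    fderiv ℝ φ z (eV l) = 0 := by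
  refine fderiv_apply_eq_of_hasDerivAt hφ ?_
  have : (fun s : ℝ => φ (z + s • eV l)) = fun _ => φ z := funext h
  rw [this]
  exact hasDerivAt_const 0 (φ z)

end Tangential

/-! ### Values of the cutoffs -/

section Values

/-- Nonnegativity of `χ`. [folklore] -/
theorem χ_nonneg (z : EuclideanSpace ℝ (Fin n)) : 0 ≤ S.χ z :=
  Finset.prod_nonneg fun _ _ => (plateau_mem_Icc _ _).1

/-- Elementary inequality between the parameters/quantities `χ` and `one`. [folklore] -/
theorem χ_le_one (z : EuclideanSpace ℝ (Fin n)) : S.χ z ≤ 1 :=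
  Finset.prod_le_one (fun _ _ => (plateau_mem_Icc _ _).1) fun _ _ => (plateau_mem_Icc _ _).2

/-- Where the cutoff `χ` equals `1`. [folklore] -/
theorem χ_eq_one {z : EuclideanSpace ℝ (Fin n)} (hz : ∀ i, |z (S.tang i)| ≤ 1 + S.ρ / 4) :
    S.χ z = 1 :=
  Finset.prod_eq_one fun i _ => plateau_eq_one _ (hz i)

/-- Nonnegativity of `β`. [folklore] -/
theorem β_nonneg (z : EuclideanSpace ℝ (Fin n)) : 0 ≤ S.β z :=
  Finset.prod_nonneg fun _ _ => (plateau_mem_Icc _ _).1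

/-- Elementary inequality between the parameters/quantities `β` and `one`. [folklore] -/
theorem β_le_one (z : EuclideanSpace ℝ (Fin n)) : S.β z ≤ 1 :=
  Finset.prod_le_one (fun _ _ => (plateau_mem_Icc _ _).1) fun _ _ => (plateau_mem_Icc _ _).2

/-- Absolute-value estimate for `β`. [cite: EliashbergMishachev2002, Thm. 3.1.2 (proof)] -/
theorem abs_β_le_one (z : EuclideanSpace ℝ (Fin n)) : |S.β z| ≤ 1 := by
  rw [abs_of_nonneg (S.β_nonneg z)]; exact S.β_le_one z

/-- Where the cutoff `β` equals `1`. [folklore] -/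
theorem β_eq_one {z : EuclideanSpace ℝ (Fin n)} (hz : ∀ i, |z (S.tang i)| ≤ 1 - S.ρ / 2) :
    S.β z = 1 :=
  Finset.prod_eq_one fun i _ => plateau_eq_one _ (hz i)

/-- Where `β` vanishes. [folklore] -/
theorem β_eq_zero {z : EuclideanSpace ℝ (Fin n)} (hz : ∃ i, 1 - S.ρ / 4 ≤ |z (S.tang i)|) :
    S.β z = 0 := by
  obtain ⟨i, hi⟩ := hz
  exact Finset.prod_eq_zero (Finset.mem_univ i) (plateau_eq_zero _ hi)

/-- Nonnegativity of `ψ`. [folklore] -/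
theorem ψ_nonneg (z : EuclideanSpace ℝ (Fin n)) : 0 ≤ S.ψ z :=
  Finset.prod_nonneg fun _ _ => (plateau_mem_Icc _ _).1

/-- Elementary inequality between the parameters/quantities `ψ` and `one`. [folklore] -/
theorem ψ_le_one (z : EuclideanSpace ℝ (Fin n)) : S.ψ z ≤ 1 :=
  Finset.prod_le_one (fun _ _ => (plateau_mem_Icc _ _).1) fun _ _ => (plateau_mem_Icc _ _).2

/-- Where the cutoff `ψ` equals `1`. [folklore] -/
theorem ψ_eq_one {z : EuclideanSpace ℝ (Fin n)} (hz : ∀ l, S.IsNormal l → |z l| ≤ 1) :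
    S.ψ z = 1 :=
  Finset.prod_eq_one fun l hl => plateau_eq_one _ (hz l (Finset.mem_filter.1 hl).2)

/-- Where `ψ` vanishes. [folklore] -/
theorem ψ_eq_zero {z : EuclideanSpace ℝ (Fin n)} (hz : ∃ l, S.IsNormal l ∧ 2 ≤ |z l|) :
    S.ψ z = 0 := by
  obtain ⟨l, hl, h2⟩ := hz
  exact Finset.prod_eq_zero (Finset.mem_filter.2 ⟨Finset.mem_univ l, hl⟩) (plateau_eq_zero _ h2)

/-- `β = 1` near any point of the small cube `{|tᵢ| < 1 - ρ/2}`, hence `dβ = 0` there. [folklore] -/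
theorem β_eventuallyEq_one {z : EuclideanSpace ℝ (Fin n)} (hz : ∀ i, |z (S.tang i)| < 1 - S.ρ / 2) :
    S.β =ᶠ[𝓝 z] fun _ => 1 := by
  have hopen : IsOpen {z' : EuclideanSpace ℝ (Fin n) | ∀ i, |z' (S.tang i)| < 1 - S.ρ / 2} := by
    simp only [setOf_forall]
    exact isOpen_iInter_of_finite fun i =>
      isOpen_lt (continuous_abs.comp (contDiff_coord (m := 0) (S.tang i)).continuous) continuous_const
  filter_upwards [hopen.mem_nhds hz] with z' hz'
  exact S.β_eq_one fun i => (hz' i).le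

/-- A formula for the derivative of `β_eq_zero`. [folklore] -/
theorem fderiv_β_eq_zero {z : EuclideanSpace ℝ (Fin n)} (hz : ∀ i, |z (S.tang i)| < 1 - S.ρ / 2) :
    fderiv ℝ S.β z = 0 := by
  rw [(S.β_eventuallyEq_one hz).fderiv_eq]; exact fderiv_const_apply 1

end Values

/-! ### The relative region: where the section is already holonomic -/

section Relative

variable {S}

/-- The hypothesis of the relative version: `Df = A` on the part of the tangential plane at
distance `≤ ρ` from `∂K` or beyond (`∃ i, 1 - ρ ≤ |tᵢ|`).
[cite: EliashbergMishachev2002, Thm. 3.1.2 (proof)] -/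
def Holonomic (S : Setup n G) : Prop :=
  ∀ z : EuclideanSpace ℝ (Fin n), (∀ l, S.IsNormal l → z l = 0) →
    (∃ i, 1 - S.ρ ≤ |z (S.tang i)|) → fderiv ℝ S.f z = S.A z

/-- Evaluation formula for `proj`. [folklore] -/
theorem proj_apply_of_isNormal' (z : EuclideanSpace ℝ (Fin n)) :
    ∀ l, S.IsNormal l → S.proj z l = 0 := fun _ hl => S.proj_apply_of_isNormal z hl

/-- Where `b` vanishes. [folklore] -/
theorem b_eq_zero_of_rim (hH : Holonomic S) (i : Fin S.k) {z : EuclideanSpace ℝ (Fin n)}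
    (hz : ∃ j, 1 - S.ρ ≤ |z (S.tang j)|) : S.b i z = 0 := by
  have h := hH (S.proj z) (proj_apply_of_isNormal' z) (by simpa only [S.proj_apply_tang] using hz)
  simp only [b, h, sub_self, smul_zero]

/-- Where `w` vanishes. [folklore] -/
theorem w_eq_zero_of_rim (hH : Holonomic S) (l : Fin n) {z : EuclideanSpace ℝ (Fin n)}
    (hz : ∃ j, 1 - S.ρ ≤ |z (S.tang j)|) : S.w l z = 0 := by
  have h := hH (S.proj z) (proj_apply_of_isNormal' z) (by simpa only [S.proj_apply_tang] using hz)
  simp only [w, h, sub_self, smul_zero]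

/-- Where `c_eq_zero_of_b` vanishes. [folklore] -/
theorem c_eq_zero_of_b_eq_zero (i : Fin S.k) {z : EuclideanSpace ℝ (Fin n)} (hz : S.b i z = 0) :
    S.c i z = 0 := by simp only [c, hz, smul_zero]

/-- Where `d_eq_zero_of_b` vanishes. [folklore] -/
theorem d_eq_zero_of_b_eq_zero (i : Fin S.k) {z : EuclideanSpace ℝ (Fin n)} (hz : S.b i z = 0) :
    S.d i z = 0 := by simp only [d, hz, smul_zero]

/-- **Relative property of the section**: `g = f` on the rim region. [folklore] -/
theorem g_eq_of_rim (hH : Holonomic S) {z : EuclideanSpace ℝ (Fin n)}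
    (hz : ∃ j, 1 - S.ρ ≤ |z (S.tang j)|) : S.g z = S.f z := by
  simp only [g, f₁, w_eq_zero_of_rim hH _ hz, smul_zero, Finset.sum_const_zero, add_zero,
    c_eq_zero_of_b_eq_zero _ (b_eq_zero_of_rim hH _ hz),
    d_eq_zero_of_b_eq_zero _ (b_eq_zero_of_rim hH _ hz)]

/-- **Pointwise relative property of the section**: `g z = f z` as soon as `Df = A` at the
projection `π z` of `z` to the tangential plane (all defects vanish there). [folklore] -/
theorem g_eq_of_fderiv_proj_eq {z : EuclideanSpace ℝ (Fin n)}
    (hz : fderiv ℝ S.f (S.proj z) = S.A (S.proj z)) : S.g z = S.f z := by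
  have hb : ∀ i, S.b i z = 0 := fun i => by simp only [b, hz, sub_self, smul_zero]
  have hw : ∀ l, S.w l z = 0 := fun l => by simp only [w, hz, sub_self, smul_zero]
  simp only [g, f₁, hw, smul_zero, Finset.sum_const_zero, add_zero,
    c_eq_zero_of_b_eq_zero _ (hb _), d_eq_zero_of_b_eq_zero _ (hb _)]

/-- The projection is determined by the tangential coordinates: a point of the tangential plane
with the same tangential coordinates as `z` is `π z`. [folklore] -/
theorem eq_proj_of_forall {z z₀ : EuclideanSpace ℝ (Fin n)} (ht : ∀ j, z₀ (S.tang j) = z (S.tang j))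
    (hn : ∀ l, S.IsNormal l → z₀ l = 0) : z₀ = S.proj z := by
  ext l
  by_cases hl : S.IsNormal l
  · rw [hn l hl, S.proj_apply_of_isNormal z hl]
  · obtain ⟨j, rfl⟩ := S.exists_tang_of_not_isNormal hl
    rw [ht j, S.proj_apply_tang]

/-- Where a defect does not vanish, the point is inside the small cube, so `β = 1` and
`dβ = 0` there. [folklore] -/
theorem abs_lt_of_b_ne_zero (hH : Holonomic S) {i : Fin S.k} {z : EuclideanSpace ℝ (Fin n)}
    (hz : S.b i z ≠ 0) (j : Fin S.k) : |z (S.tang j)| < 1 - S.ρ := by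
  by_contra hle
  exact hz (b_eq_zero_of_rim hH i ⟨j, not_lt.1 hle⟩)

/-- Where the cutoff `β` equals `1`. [folklore] -/
theorem β_eq_one_of_b_ne_zero (hH : Holonomic S) {i : Fin S.k} {z : EuclideanSpace ℝ (Fin n)}
    (hz : S.b i z ≠ 0) : S.β z = 1 :=
  S.β_eq_one fun j => by have := abs_lt_of_b_ne_zero hH hz j; linarith [S.hρ]

/-- A formula for the derivative of `β_eq_zero_of_b_ne_zero`. [folklore] -/
theorem fderiv_β_eq_zero_of_b_ne_zero (hH : Holonomic S) {i : Fin S.k}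
    {z : EuclideanSpace ℝ (Fin n)} (hz : S.b i z ≠ 0) : fderiv ℝ S.β z = 0 :=
  S.fderiv_β_eq_zero fun j => by have := abs_lt_of_b_ne_zero hH hz j; linarith [S.hρ]

/-- **Relative property of the shear**: `h = id` within `ρ/4` of `∂K` (and beyond). [folklore] -/
theorem shear_eq_of_rim {z : EuclideanSpace ℝ (Fin n)} (hz : ∃ j, 1 - S.ρ / 4 ≤ |z (S.tang j)|) :
    S.shear z = z := by
  have hβ : S.β z = 0 := S.β_eq_zero hz
  simp only [shear, Θtot, θ, hβ, mul_zero, zero_mul, Finset.sum_const_zero, zero_smul, add_zero]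

/-- The shear is the identity off the normal cutoff. [folklore] -/
theorem shear_eq_of_ψ_eq_zero {z : EuclideanSpace ℝ (Fin n)} (hz : S.ψ z = 0) : S.shear z = z := by
  simp only [shear, hz, mul_zero, zero_smul, add_zero]

/-- The shear moves only the wiggle coordinate `κ`. [folklore] -/
theorem shear_apply_of_ne (z : EuclideanSpace ℝ (Fin n)) {l : Fin n} (hl : l ≠ S.κ) :
    S.shear z l = z l :=
  add_smul_eV_apply_of_ne z _ hl

end Relative

/-! ### The projection as a linear map; dependence on tangential coordinates only -/

section Proj

/-- `proj` as a continuous linear map. [cite: EliashbergMishachev2002, Thm. 3.1.2 (proof)] -/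
def projL : EuclideanSpace ℝ (Fin n) →L[ℝ] EuclideanSpace ℝ (Fin n) :=
  ∑ i : Fin S.k, (EuclideanSpace.proj (𝕜 := ℝ) (S.tang i)).smulRight (eV (S.tang i))

/-- Evaluation formula for `projL`. [folklore] -/
theorem projL_apply (z : EuclideanSpace ℝ (Fin n)) : S.projL z = S.proj z := by
  simp [projL, proj]

/-- Auxiliary item `proj_eq_projL` of the explicit holonomic-approximation construction. [cite:
EliashbergMishachev2002, Thm. 3.1.2 (proof)] -/
theorem proj_eq_projL : S.proj = ⇑S.projL := funext fun z => (S.projL_apply z).symm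

/-- Fréchet derivative of `proj` (explicit formula). [folklore] -/
theorem hasFDerivAt_proj (z : EuclideanSpace ℝ (Fin n)) : HasFDerivAt S.proj S.projL z := by
  rw [S.proj_eq_projL]; exact S.projL.hasFDerivAt

/-- Auxiliary item `projL_eV_tang` of the explicit holonomic-approximation construction. [cite:
EliashbergMishachev2002, Thm. 3.1.2 (proof)] -/
theorem projL_eV_tang (j : Fin S.k) : S.projL (eV (S.tang j)) = eV (S.tang j) := by
  rw [S.projL_apply]
  ext l
  by_cases hl : S.IsNormal l
  · rw [S.proj_apply_of_isNormal _ hl, eV_apply_of_ne (S.ne_tang_of_isNormal hl j)]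
  · -- `l` is tangential: `l = tang i` for `i = ⟨l, _⟩`
    have hlt : l.val < S.k := not_le.1 hl
    have hl' : l = S.tang ⟨l.val, hlt⟩ := Fin.ext (by simp)
    rw [hl', S.proj_apply_tang]

/-- `proj` under the condition `tang_eq` (explicit formula). [folklore] -/
theorem proj_eq_of_tang_eq {z z' : EuclideanSpace ℝ (Fin n)} (h : ∀ j, z' (S.tang j) = z (S.tang j)) :
    S.proj z' = S.proj z := by
  unfold proj; simp_rw [h]

/-- `χ` under the condition `tang_eq` (explicit formula). [folklore] -/
theorem χ_eq_of_tang_eq {z z' : EuclideanSpace ℝ (Fin n)} (h : ∀ j, z' (S.tang j) = z (S.tang j)) :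
    S.χ z' = S.χ z := by
  unfold χ; simp_rw [h]

/-- `b` under the condition `tang_eq` (explicit formula). [folklore] -/
theorem b_eq_of_tang_eq (i : Fin S.k) {z z' : EuclideanSpace ℝ (Fin n)}
    (h : ∀ j, z' (S.tang j) = z (S.tang j)) : S.b i z' = S.b i z := by
  unfold b; rw [S.χ_eq_of_tang_eq h, S.proj_eq_of_tang_eq h]

/-- `w` under the condition `tang_eq` (explicit formula). [folklore] -/
theorem w_eq_of_tang_eq (l : Fin n) {z z' : EuclideanSpace ℝ (Fin n)}
    (h : ∀ j, z' (S.tang j) = z (S.tang j)) : S.w l z' = S.w l z := by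
  unfold w; rw [S.χ_eq_of_tang_eq h, S.proj_eq_of_tang_eq h]

/-- Auxiliary item `b_proj` of the explicit holonomic-approximation construction. [cite:
EliashbergMishachev2002, Thm. 3.1.2 (proof)] -/
theorem b_proj (i : Fin S.k) (z : EuclideanSpace ℝ (Fin n)) : S.b i (S.proj z) = S.b i z :=
  S.b_eq_of_tang_eq i fun j => S.proj_apply_tang z j

/-- Auxiliary item `w_proj` of the explicit holonomic-approximation construction. [cite:
EliashbergMishachev2002, Thm. 3.1.2 (proof)] -/
theorem w_proj (l : Fin n) (z : EuclideanSpace ℝ (Fin n)) : S.w l (S.proj z) = S.w l z :=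
  S.w_eq_of_tang_eq l fun j => S.proj_apply_tang z j

/-- **Partials of the defects are read on the plane**: `∂ⱼbᵢ(z) = ∂ⱼbᵢ(π z)`. [folklore] -/
theorem fderiv_b_apply_eV_tang {S : Setup n G} (hf : ContDiff ℝ ∞ S.f) (hA : ContDiff ℝ ∞ S.A)
    (i j : Fin S.k) (z : EuclideanSpace ℝ (Fin n)) :
    fderiv ℝ (S.b i) z (eV (S.tang j)) = fderiv ℝ (S.b i) (S.proj z) (eV (S.tang j)) := by
  have hcomp : S.b i = S.b i ∘ S.proj := funext fun z => (S.b_proj i z).symm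
  have hd : DifferentiableAt ℝ (S.b i) (S.proj z) := (contDiff_b hf hA i).differentiable (by simp) _
  conv_lhs => rw [hcomp]
  rw [fderiv_comp z hd (S.hasFDerivAt_proj z).differentiableAt, (S.hasFDerivAt_proj z).fderiv,
    ContinuousLinearMap.comp_apply, S.projL_eV_tang]

/-- The derivative of `w` in a coordinate direction (`tang`). [folklore] -/
theorem fderiv_w_apply_eV_tang {S : Setup n G} (hf : ContDiff ℝ ∞ S.f) (hA : ContDiff ℝ ∞ S.A)
    (l : Fin n) (j : Fin S.k) (z : EuclideanSpace ℝ (Fin n)) :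
    fderiv ℝ (S.w l) z (eV (S.tang j)) = fderiv ℝ (S.w l) (S.proj z) (eV (S.tang j)) := by
  have hcomp : S.w l = S.w l ∘ S.proj := funext fun z => (S.w_proj l z).symm
  have hd : DifferentiableAt ℝ (S.w l) (S.proj z) := (contDiff_w hf hA l).differentiable (by simp) _
  conv_lhs => rw [hcomp]
  rw [fderiv_comp z hd (S.hasFDerivAt_proj z).differentiableAt, (S.hasFDerivAt_proj z).fderiv,
    ContinuousLinearMap.comp_apply, S.projL_eV_tang]

end Proj

end Setup

end Literature.Topology.Immersions.HolonomicApprox
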